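import Summits.RiemannHypothesis.RiemannHypothesis.Theses.WeilSemilocal
import HarnessLib

/-!
# Route `WeilSemilocal` — the ASSEMBLY item (pure logic, RH-FREE)

The route `route-RiemannHypothesis-WeilSemilocal` (planner weil-routes-1, rev 2/3) closes the W-P(P2) rung leaf
`SemilocalClassLaw.SemilocalClassLawAll` (C-I(a): for every prime `q` and every prime `q' > q`,
`a*(S_q) = weilSemilocalThreshold (Nat.primesBelow q) < (log q')/2`) from FIVE range pieces of that one sentence:
HEAD `q < 80`, ROWS `80 ≤ q < 157`, WALLS-I `157 ≤ q < 10⁴`, WALLS-II `10⁴ ≤ q < 6·10⁴`, TAIL `q ≥ 6·10⁴`.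
This file proves the item `Assembly` (stmt-RiemannHypothesis-19095): the five pieces imply the leaf — a five-way case
split on `q`, no tree theorem used.  Nothing here bears on the truth of RH (the leaf is an UPPER-clause statement about
truncated Weil forms; cell `rh-explicit`, typing lane cc-s2-1 gen20).
-/

set_option linter.dupNamespace false  -- the mandated namespace repeats `RiemannHypothesis`

namespace Summit.RiemannHypothesis.RiemannHypothesis.Theorems.WeilSemilocalRoute

open Summit.RiemannHypothesis.RiemannHypothesis.Theses.WeilSemilocal

/-- **ASSEMBLY of route `WeilSemilocal`** (item stmt-RiemannHypothesis-19095): HEAD → ROWS → WALLS-I → WALLS-II → TAIL →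
`SemilocalClassLawAll`, by the case split `q < 80 / q < 157 / q < 10⁴ / q < 6·10⁴ / 6·10⁴ ≤ q`. [this cell; pure logic] -/
theorem assembly_proof : Summit.RiemannHypothesis.RiemannHypothesis.Theses.WeilSemilocal.Assembly := by
  unfold Theses.WeilSemilocal.Assembly
  intro hH hR hW hM hT
  unfold Theses.WeilSemilocal.SemilocalClassLawHead at hH
  unfold Theses.WeilSemilocal.SemilocalRowsToOneFiftySeven at hR
  unfold Theses.WeilSemilocal.SemilocalWallsToTenThousand at hW
  unfold Theses.WeilSemilocal.SemilocalWallsToSixtyThousand at hM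
  unfold Theses.WeilSemilocal.SemilocalWallsFromSixtyThousand at hT
  unfold Theorems.SemilocalClassLaw.SemilocalClassLawAll
  intro q hq q' hq' hqq'
  rcases Nat.lt_or_ge q 80 with h80 | h80
  · exact hH q hq h80 q' hq' hqq'
  rcases Nat.lt_or_ge q 157 with h157 | h157
  · exact hR q hq h80 h157 q' hq' hqq'
  rcases Nat.lt_or_ge q 10000 with h1 | h1
  · exact hW q hq h157 h1 q' hq' hqq'
  rcases Nat.lt_or_ge q 60000 with h6 | h6
  · exact hM q hq h1 h6 q' hq' hqq'
  · exact hT q hq h6 q' hq' hqq'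

end Summit.RiemannHypothesis.RiemannHypothesis.Theorems.WeilSemilocalRoute
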